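import Summits.QuantumFields.BalabanUV.Beta.EriceRemainderEnclosureHistoryAutonomyComparisonAgeCompositionGeometricSocket
import Summits.QuantumFields.BalabanUV.Beta.EriceRemainderEnclosureHistoryAutonomyComparisonAgeCompositionYoungMass

/-!
# EriceRemainderEnclosureHistoryAutonomyComparisonAgeCompositionKeyFreeTwoAgesPrep — (E115j) route (N), first order: PREPARATIONS FOR THE FIRST END PROVED BY THE
# STRUCTURAL (KEY-FREE) ROUTE ((E115k) `…KeyFreeTwoAges`): the block-geometric sum, the decimal letters of `√2∕2`, the two zone arithmetics, and the two-sided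
# per-row variation of a lone old surplus along the flow.  Context of the pair of files:  An integration test of (E115a–i): the row induction with the GEOMETRIC SOCKET
# (E115i) for the first term, the lone-old-age variation ((E115e)-type, two-sided: §2), the remainder by (E115c)+(E115d) on the young reads cut at the pin with the
# young total mass of (E115f), and a light zone at the last `12·y` rows.  RESULT (**`flow_keyfree_two_ages`**): `B` isotone with floor `b > 0` dominating `L ≥ 0`
# on the ages `< K`, `h` a box solution, two loaded ages `1 ≤ y < o < K ≤ N` (kernel = `KL y + KL o`, undamped), and
#     `(o : ℝ) ≥ (87 + 138·(L_y·h_y∕b))·y`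
# ⟹ the zero-tailed solution of `ε = 1_{[0,N]} − R_o ε − R_y ε` satisfies `0 ≤ ε ≤ 1` at every depth.  By (E115a) `sol_eq_sum_indicator` (every admissible excess is a
# non-negative combination of truncated indicators, and the solution on the horizon `N` of `1_{[0,J]}` is the one on the horizon `J`) this is the two-age END for every
# admissible excess.  HONEST COMPARISON: two ages at EVERY ratio are already in the tree ((E91b) `flow_nonneg_two_ages_all`, by the young contraction against a slowly
# varying old read); the constants here are not optimised (`87`, `138`, the light zone `12y`, `√2∕2` everywhere for the loads) and the hypothesis carries the flow letter
# `L_y·h_y∕b` (the young age's budget at the pin against the floor, from (E115f)'s use of the floor); the point is that NO supersolution (KEY), NO monotonicity (MONO),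
# NO certificate table enters — only the sockets of the age induction, which compose formally as README `HOME/b2b-balaban-beta-d4-p2/g96/README.md` §3 says.

Cell `pub-balaban`, β-function sub-cell, BINDER row D4 «RemainderConst leaves for Bałaban's split» (`HOME/BINDER-OWNERS.md`; owner lineage `b2b-balaban-beta-an4`;
this file by co-owner #2 lineage `b2b-balaban-beta-d4-p2`, generation 96), β-FLOW TEAM duty (1), FREEZE (0) honoured (def-free; imports (E115i), (E115f); uses (E115i)
`sol_ge_deep_first_sub_var`-type assembly through (E115c) `sol_ge_first_sub_var` and (E115i) `sol_ge_deep_floor_sub_geom_var`, (E115d) `var_read_le` ∕ `read_eq_sum_ages` ∕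
`window_succ`, (E115e) `lone_kernel_tail_form`, (E115f) `young_total_mass_le` ∕ `old_kernel_facts`, (E115b) `young_kernel_facts` ∕ `young_indicator_sol_bounds`,
(E58b) `mul_invSq_add_le`, (E48a) `strictAnti_of_memFlow` BY NAME; nothing restated).

HONEST FRAMING (page 1, verbatim and binding).  *"Discharging BetaPertH makes Bałaban's UV stability UNCONDITIONAL — a real constructive-QFT result; it is
NOT the continuum limit and NOT the Clay problem."*  THIS FILE DISCHARGES NOTHING OF THE KIND.  Elementary real analysis about ABSTRACT functionals on a box
]0,γ]^ℕ with displayed floors, profiles and signs, and the FIRST-ORDER renewal objects of route (N) built from them — hypotheses of a census, not facts; the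
form, signs, ages and moments of Bałaban's (1.22) limit functional are NOT PRINTED ([I] p. 298; GAPS G-t4-U2-1∕-2) and NOT asserted.  Row D4 class
UNCHANGED (critical-path width 0; instance 0∕1; D4 DISCHARGE NO DATE).  HONEST DEPENDENCY: continuum YM on T⁴ ⇐ BetaPertH ∧ nine spine estimates (0/9
proved); BetaPertH ⇐ (D1) ∧ (D4) ∧ CAP+tail; G-an2-4 gates asym, D1 and NE2/3/4.

NOT CLAIMED: any ratio below the displayed threshold; more than two ages; anything printed — NOT B12 Thm 2, NOT BetaPertH, NOT continuum, NOT Clay.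

WHAT IS PROVED ([folklore]; 0 `def`, 0 sorry).  §1 `geom_block_sum_le` (`Σ_{J∈[n,M)} ρ^{⌊(J−n)∕y⌋} ≤ y∕(1−ρ)`), `sqrt_two_half_facts`, `light_zone_arith`, `geom_zone_arith`
(pure real arithmetic of the two zones).  §2 `lone_read_eq`, **`lone_sol_step_abs_le`** (lone age, `0 ≤ v ≤ 1`: `|v J − v (J+1)| ≤ |e J − e (J+1)| + o·(c J − c (J+1)) +
c (J+1)`), **`flow_lone_step_abs_le`** (`≤ |e J − e (J+1)| + (5∕2)·c n` along the flow, `J ≥ n`).  The END itself is (E115k).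
-/
noncomputable section
open Finset

namespace Summit.QuantumFields.BalabanUV.Beta.EriceRemainderEnclosureHistoryAutonomyComparisonAgeCompositionKeyFreeTwoAgesPrep

open Literature.MathematicalPhysics.QuantumFieldTheory.Balaban1983to89
open Literature.MathematicalPhysics.QuantumFieldTheory.Balaban1983to89.T4BetaStationary
open Literature.MathematicalPhysics.QuantumFieldTheory.Balaban1983to89.T4BetaFlowWellPosed
open Summit.QuantumFields.BalabanUV.Beta.EriceRemainderEnclosureHistoryAutonomyComparisonAgeComposition
open Summit.QuantumFields.BalabanUV.Beta.EriceRemainderEnclosureHistoryAutonomyComparisonAgeCompositionBVStability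
open Summit.QuantumFields.BalabanUV.Beta.EriceRemainderEnclosureHistoryAutonomyComparisonAgeCompositionBVStabilityFlow (young_kernel_facts young_indicator_sol_bounds)
open Summit.QuantumFields.BalabanUV.Beta.EriceRemainderEnclosureHistoryAutonomyComparisonAgeCompositionKeyFree (sol_ge_first_sub_var)
open Summit.QuantumFields.BalabanUV.Beta.EriceRemainderEnclosureHistoryAutonomyComparisonAgeCompositionReadVariation (var_read_le read_eq_sum_ages window_succ)
open Summit.QuantumFields.BalabanUV.Beta.EriceRemainderEnclosureHistoryAutonomyComparisonAgeCompositionOldRegularity (lone_kernel_tail_form)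
open Summit.QuantumFields.BalabanUV.Beta.EriceRemainderEnclosureHistoryAutonomyComparisonAgeCompositionYoungMass (young_total_mass_le old_kernel_facts)
open Summit.QuantumFields.BalabanUV.Beta.EriceRemainderEnclosureHistoryAutonomyComparisonAgeCompositionGeometricSocket (sol_ge_deep_floor_sub_geom_var)
open Summit.QuantumFields.BalabanUV.Beta.EriceRemainderEnclosureHistoryAutonomyComparisonAffineProfile (mul_invSq_add_le)
open Summit.QuantumFields.BalabanUV.Beta.EriceRemainderEnclosureHistoryAutonomyOrder (strictAnti_of_memFlow)

/-! ## §1 Two small sums -/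

/-- **GEOMETRIC BLOCK SUM.**  `0 ≤ ρ < 1`, `y ≥ 1`: `Σ_{J∈[n,M)} ρ^{⌊(J−n)∕y⌋} ≤ y∕(1−ρ)` (blocks of `y` equal terms). [folklore] -/
theorem geom_block_sum_le {ρ : ℝ} (hρ0 : 0 ≤ ρ) (hρ1 : ρ < 1) {y : ℕ} (hy : 1 ≤ y) (n M : ℕ) :
    ∑ J ∈ Ico n M, ρ ^ ((J - n) / y) ≤ (y : ℝ) / (1 - ρ) := by
  -- reindex and extend to a whole number of blocks
  have e1 : ∑ J ∈ Ico n M, ρ ^ ((J - n) / y) = ∑ i ∈ range (M - n), ρ ^ (i / y) := by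
    rw [sum_Ico_eq_sum_range]; exact sum_congr rfl fun i _ => by rw [show n + i - n = i by omega]
  rw [e1]
  set D := (M - n) / y + 1 with hD
  have hsub : range (M - n) ⊆ range (y * D) := range_subset_range.mpr (by
    have := Nat.lt_mul_div_succ (M - n) (show 0 < y by omega); rw [hD]; linarith [Nat.div_add_mod (M - n) y])
  have hblocks : ∀ D', ∑ i ∈ range (y * D'), ρ ^ (i / y) = (y : ℝ) * ∑ d ∈ range D', ρ ^ d := by
    intro D'
    induction D' with
    | zero => simp
    | succ D' ih =>
      rw [show y * (D' + 1) = y * D' + y by ring, sum_range_add, ih, sum_range_succ, mul_add]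
      congr 1
      rw [show (y : ℝ) * ρ ^ D' = ∑ _i ∈ range y, ρ ^ D' by rw [sum_const, card_range, nsmul_eq_mul]]
      exact sum_congr rfl fun i hi => by rw [show (y * D' + i) / y = D' from by
        rw [Nat.add_comm, Nat.add_mul_div_left _ _ (by omega), Nat.div_eq_of_lt (mem_range.mp hi), zero_add]]
  calc ∑ i ∈ range (M - n), ρ ^ (i / y) ≤ ∑ i ∈ range (y * D), ρ ^ (i / y) :=
        sum_le_sum_of_subset_of_nonneg hsub fun i _ _ => pow_nonneg hρ0 _
    _ = (y : ℝ) * ∑ d ∈ range D, ρ ^ d := hblocks D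
    _ ≤ (y : ℝ) * (1 / (1 - ρ)) := by
        refine mul_le_mul_of_nonneg_left ?_ (Nat.cast_nonneg y)
        have hg : (1 - ρ) * ∑ d ∈ range D, ρ ^ d = 1 - ρ ^ D := mul_neg_geom_sum ρ D
        rw [le_div_iff₀ (by linarith), mul_comm]
        have := pow_nonneg hρ0 D; linarith
    _ = (y : ℝ) / (1 - ρ) := by ring

/-- Decimal facts about `√2∕2`: `√2∕2 ≤ 0.70715`, `(√2∕2)^12 = 1∕64`. [folklore] -/
theorem sqrt_two_half_facts : Real.sqrt 2 / 2 ≤ 0.70715 ∧ (Real.sqrt 2 / 2) ^ 12 = 1 / 64 := by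
  have hs : Real.sqrt 2 ^ 2 = 2 := Real.sq_sqrt (by norm_num)
  have hs0 : 0 ≤ Real.sqrt 2 := Real.sqrt_nonneg 2
  constructor
  · nlinarith
  · have : (Real.sqrt 2 / 2) ^ 12 = (Real.sqrt 2 ^ 2) ^ 6 / 2 ^ 12 := by ring
    rw [this, hs]; norm_num

/-- The light-zone arithmetic: `Ry ≤ A ≤ 0.70715`, `Ro ≤ 12·y·c`, `o·c ≤ 0.70715`, `90·y ≤ o`, `c ≥ 0` ⟹ `0 ≤ 1 − Ro − Ry`. [folklore] -/
theorem light_zone_arith {o y c A Ry Ro : ℝ} (hA : A ≤ 0.70715) (hRy : Ry ≤ A) (hRo : Ro ≤ 12 * y * c) (hc : 0 ≤ c)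
    (hoc : o * c ≤ 0.70715) (ho : 90 * y ≤ o) : 0 ≤ 1 - Ro - Ry := by
  have h1 : 90 * y * c ≤ o * c := mul_le_mul_of_nonneg_right ho hc
  have h2 : 12 * y * c ≤ 12 * (0.70715 / 90) := by linarith
  linarith

/-- The geometric-zone arithmetic (the letters of §3: `U` = deep young END value, `V` = old surplus at the pin, `A`, `Bo` = the two window loads, `c` = old rate,
`Λ` = young mass bound, `GV` = weighted variation, `Var` = remainder variation). [folklore] -/
theorem geom_zone_arith {o y Λ U V A Bo c GV Var T0 ε : ℝ} (ho : 90 * y + 140 * Λ ≤ o) (ho0 : 0 < o) (hy : 1 ≤ y) (hΛ : 0 ≤ Λ)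
    (hA1 : A ≤ 0.70715) (hBo : Bo ≤ 0.70715) (hU : 1 - A ≤ U) (hV : 1 - Bo ≤ V)
    (hoc : o * c ≤ 0.70715) (hGV : GV ≤ 5 / 2 * c * (y / (1 - A)) + 1 / 64) (hVar : Var ≤ 4 * c * Λ)
    (h1 : T0 - Var / (1 - A) ≤ ε) (h2 : U * V - GV ≤ T0) : 0 ≤ ε := by
  have hD : 0 < 1 - A := by linarith
  have hσA : 0.29285 ≤ 1 - A := by linarith
  have hσB : 0.29285 ≤ 1 - Bo := by linarith
  have hU0 : 0 ≤ U := by linarith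
  have hUV : 0.0857 ≤ U * V := by
    have q1 : (1 - A) * (1 - Bo) ≤ U * (1 - Bo) := mul_le_mul_of_nonneg_right hU (by linarith)
    have q2 : U * (1 - Bo) ≤ U * V := mul_le_mul_of_nonneg_left hV hU0
    have q3 : 0.29285 * (1 - Bo) ≤ (1 - A) * (1 - Bo) := mul_le_mul_of_nonneg_right hσA (by linarith)
    have q4 : (0.29285 : ℝ) * 0.29285 ≤ 0.29285 * (1 - Bo) := mul_le_mul_of_nonneg_left hσB (by norm_num)
    linarith
  have hrem : Var / (1 - A) ≤ 4 * c * Λ / (1 - A) := div_le_div_of_nonneg_right hVar hD.le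
  have hkey : (5 / 2 * c * y + 4 * c * Λ) / (1 - A) ≤ U * V - 1 / 64 := by
    rw [div_le_iff₀ hD]
    have hT : 0 ≤ 5 / 2 * y + 4 * Λ := by linarith
    have lhs : o * (5 / 2 * c * y + 4 * c * Λ) ≤ 0.70715 * (5 / 2 * y + 4 * Λ) := by
      have e4 : o * (5 / 2 * c * y + 4 * c * Λ) = (o * c) * (5 / 2 * y + 4 * Λ) := by ring
      rw [e4]; exact mul_le_mul_of_nonneg_right hoc hT
    have h8 : 0.0204 ≤ (U * V - 1 / 64) * (1 - A) := by
      have q5 : 0.07 * (1 - A) ≤ (U * V - 1 / 64) * (1 - A) := mul_le_mul_of_nonneg_right (by linarith) hD.le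
      have q6 : (0.07 : ℝ) * 0.29285 ≤ 0.07 * (1 - A) := mul_le_mul_of_nonneg_left hσA (by norm_num)
      linarith
    have rhs : 0.0204 * o ≤ o * ((U * V - 1 / 64) * (1 - A)) := by
      have := mul_le_mul_of_nonneg_left h8 ho0.le; linarith
    have hfin : o * (5 / 2 * c * y + 4 * c * Λ) ≤ o * ((U * V - 1 / 64) * (1 - A)) := by linarith
    exact le_of_mul_le_mul_left hfin ho0
  have e3 : (5 / 2 * c * y + 4 * c * Λ) / (1 - A) = 5 / 2 * c * (y / (1 - A)) + 4 * c * Λ / (1 - A) := by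
    rw [add_div, mul_div_assoc]
  linarith

/-! ## §2 The lone old surplus varies per row by at most `(5∕2)·c` -/

variable {B : (ℕ → ℝ) → ℝ} {γ b gIR : ℝ} {L : ℕ → ℝ} {K : ℕ} {h : ℕ → ℝ}

/-- **THE LONE READ IN CLOSED FORM.**  For the undamped lone kernel of the age `o < K`: `R v m = (L_oh_{m+o}³∕2)·Σ_{l<min o N} v (m+1+l)`. [folklore] -/
theorem lone_read_eq {o : ℕ} (hoK : o < K)
    {KL : ℕ → ℕ → ℕ → ℝ} (hKL : ∀ k n l, KL k n l = if 0 < k ∧ k < K ∧ l < k then L k * h (n + k) ^ 3 / 2 else 0)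
    {N : ℕ} {Ro : (ℕ → ℝ) → ℕ → ℝ} (hRo : ∀ u m, Ro u m = ∑ l ∈ range N, KL o m l * u (m + 1 + l)) (v : ℕ → ℝ) (m : ℕ) :
    Ro v m = L o * h (m + o) ^ 3 / 2 * ∑ l ∈ range (min o N), v (m + 1 + l) := by
  have hKt : ∀ m l, KL o m l = ∑ k ∈ Ico (l + 1) K, (fun k m => if k = o then L o * h (m + o) ^ 3 / 2 else 0) k m :=
    fun m l => lone_kernel_tail_form hoK hKL m l
  rw [read_eq_sum_ages hRo hKt v m]
  by_cases ho : 1 ≤ o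
  · rw [show (∑ k ∈ Ico 1 K, (fun k m => if k = o then L o * h (m + o) ^ 3 / 2 else (0 : ℝ)) k m * ∑ l ∈ range (min k N), v (m + 1 + l))
        = ∑ k ∈ Ico 1 K, (if k = o then L o * h (m + o) ^ 3 / 2 * ∑ l ∈ range (min o N), v (m + 1 + l) else 0) from
        sum_congr rfl fun k _ => by simp only; split_ifs with hk <;> simp [hk]]
    rw [sum_ite_eq' (Ico 1 K) o, if_pos (mem_Ico.mpr ⟨ho, hoK⟩)]
  · -- o = 0: both sides vanish
    have ho0 : o = 0 := by omega
    subst ho0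
    simp

/-- **THE LONE SURPLUS VARIES PER ROW BY AT MOST `o·(c J − c (J+1)) + c (J+1)` plus the step of the excess**, for a solution with `0 ≤ v ≤ 1` (`c m = L_oh_{m+o}³∕2`
non-increasing in `m`, `N ≥ o`). [folklore] -/
theorem lone_sol_step_abs_le {o : ℕ} (hoK : o < K) {N : ℕ} (hoN : o ≤ N)
    {KL : ℕ → ℕ → ℕ → ℝ} (hKL : ∀ k n l, KL k n l = if 0 < k ∧ k < K ∧ l < k then L k * h (n + k) ^ 3 / 2 else 0)
    {Ro : (ℕ → ℝ) → ℕ → ℝ} (hRo : ∀ u m, Ro u m = ∑ l ∈ range N, KL o m l * u (m + 1 + l))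
    (hc0 : ∀ m, 0 ≤ L o * h (m + o) ^ 3 / 2) (hcmono : ∀ m, L o * h (m + 1 + o) ^ 3 / 2 ≤ L o * h (m + o) ^ 3 / 2)
    {e v : ℕ → ℝ} (hrec : ∀ m, v m = e m - Ro v m) (hv01 : ∀ m, 0 ≤ v m ∧ v m ≤ 1) (J : ℕ) :
    |v J - v (J + 1)| ≤ |e J - e (J + 1)| + ((o : ℝ) * (L o * h (J + o) ^ 3 / 2 - L o * h (J + 1 + o) ^ 3 / 2) + L o * h (J + 1 + o) ^ 3 / 2) := by
  have hmin : min o N = o := min_eq_left hoN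
  set W : ℕ → ℝ := fun m => ∑ l ∈ range o, v (m + 1 + l) with hW
  have hR : ∀ m, Ro v m = L o * h (m + o) ^ 3 / 2 * W m := fun m => by rw [lone_read_eq hoK hKL hRo v m, hmin]
  have hWs : W (J + 1) = W J + v (J + 1 + o) - v (J + 1) := by simp only [hW]; exact window_succ v J o
  have hW0 : 0 ≤ W J := sum_nonneg fun l _ => (hv01 _).1
  have hWo : W J ≤ o := by
    calc W J ≤ ∑ l ∈ range o, (1 : ℝ) := sum_le_sum fun l _ => (hv01 _).2
      _ = o := by simp
  have e1 : v J - v (J + 1) = (e J - e (J + 1)) - (L o * h (J + o) ^ 3 / 2 * W J - L o * h (J + 1 + o) ^ 3 / 2 * W (J + 1)) := by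
    rw [hrec J, hrec (J + 1), hR J, hR (J + 1)]; ring
  rw [e1, hWs]
  have hd0 := hcmono J
  have hc1 := hc0 (J + 1)
  have h1 := (hv01 (J + 1)).1; have h2 := (hv01 (J + 1)).2; have h3 := (hv01 (J + 1 + o)).1; have h4 := (hv01 (J + 1 + o)).2
  set cJ := L o * h (J + o) ^ 3 / 2
  set cJ1 := L o * h (J + 1 + o) ^ 3 / 2
  have hd : 0 ≤ cJ - cJ1 := by linarith
  have hA : |cJ * W J - cJ1 * (W J + v (J + 1 + o) - v (J + 1))| ≤ (o : ℝ) * (cJ - cJ1) + cJ1 := by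
    rw [show cJ * W J - cJ1 * (W J + v (J + 1 + o) - v (J + 1)) = (cJ - cJ1) * W J - cJ1 * (v (J + 1 + o) - v (J + 1)) by ring]
    refine (abs_sub _ _).trans ?_
    have hB : |(cJ - cJ1) * W J| ≤ (o : ℝ) * (cJ - cJ1) := by
      rw [abs_of_nonneg (mul_nonneg hd hW0)]; nlinarith
    have hC : |cJ1 * (v (J + 1 + o) - v (J + 1))| ≤ cJ1 := by
      rw [abs_mul, abs_of_nonneg hc1]
      have : |v (J + 1 + o) - v (J + 1)| ≤ 1 := by rw [abs_le]; constructor <;> linarith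
      nlinarith
    linarith
  have := abs_sub (e J - e (J + 1)) (cJ * W J - cJ1 * (W J + v (J + 1 + o) - v (J + 1)))
  linarith

/-- **ALONG THE FLOW: `|v J − v (J+1)| ≤ |e J − e (J+1)| + (5∕2)·L_oh_{n+o}³∕2` for `J ≥ n`.**  Concavity through the origin ((E58b) `mul_invSq_add_le`:
`(J+o)·a_{J+o+1} ≤ (J+o+1)·a_{J+o}`) gives `o·(c J − c (J+1)) ≤ (3∕2)·c J`, and `c` is non-increasing. [folklore] -/
theorem flow_lone_step_abs_le (hmono : ∀ u v : ℕ → ℝ, SeqBox γ u → SeqBox γ v → (∀ j, u j ≤ v j) → B u ≤ B v)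
    (hL : ∀ k, 0 ≤ L k) (hb : 0 < b) (hlo : ∀ u, SeqBox γ u → b ≤ B u) (hh : SeqBox γ h) (hf : MemFlow B gIR h)
    {o : ℕ} (hoK : o < K) {N : ℕ} (hoN : o ≤ N)
    {KL : ℕ → ℕ → ℕ → ℝ} (hKL : ∀ k n l, KL k n l = if 0 < k ∧ k < K ∧ l < k then L k * h (n + k) ^ 3 / 2 else 0)
    {Ro : (ℕ → ℝ) → ℕ → ℝ} (hRo : ∀ u m, Ro u m = ∑ l ∈ range N, KL o m l * u (m + 1 + l))
    {e v : ℕ → ℝ} (hrec : ∀ m, v m = e m - Ro v m) (hv01 : ∀ m, 0 ≤ v m ∧ v m ≤ 1) {n J : ℕ} (hnJ : n ≤ J) :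
    |v J - v (J + 1)| ≤ |e J - e (J + 1)| + 5 / 2 * (L o * h (n + o) ^ 3 / 2) := by
  have hpos : ∀ j, 0 < h j := fun j => (hh j).1
  have hgIR : 0 < gIR := by rw [← hf.1]; exact hpos 0
  have hanti := (strictAnti_of_memFlow hb hlo hh hf).antitone
  have hLo := hL o
  have hc0 : ∀ m, 0 ≤ L o * h (m + o) ^ 3 / 2 := fun m => by have := hpos (m + o); positivity
  have hcmono' : ∀ m m', m ≤ m' → L o * h (m' + o) ^ 3 / 2 ≤ L o * h (m + o) ^ 3 / 2 := fun m m' hmm' => by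
    have h1 : h (m' + o) ≤ h (m + o) := hanti (by omega)
    have h2 := pow_le_pow_left₀ (le_of_lt (hpos (m' + o))) h1 3
    nlinarith
  have hcmono : ∀ m, L o * h (m + 1 + o) ^ 3 / 2 ≤ L o * h (m + o) ^ 3 / 2 := fun m => hcmono' m (m + 1) (by omega)
  have hstep := lone_sol_step_abs_le hoK hoN hKL hRo hc0 hcmono hrec hv01 J
  -- o·(c J − c (J+1)) ≤ (3/2)·c J
  set p := h (J + o) with hp
  set q := h (J + 1 + o) with hq
  have hp0 : 0 < p := hpos _
  have hq0 : 0 < q := hpos _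
  have hqp : q ≤ p := hanti (by omega)
  have hcv := mul_invSq_add_le hmono hb hlo hgIR hh hf (J + o) 1
  rw [show J + o + 1 = J + 1 + o by ring] at hcv
  -- (J+o)·p² ≤ (J+o+1)·q²
  have hcv' : ((J + o : ℕ) : ℝ) * p ^ 2 ≤ (((J + o : ℕ) : ℝ) + 1) * q ^ 2 := by
    rw [div_eq_mul_inv, div_eq_mul_inv, one_mul, one_mul] at hcv
    have e1 : ((J + o : ℕ) : ℝ) * (q ^ 2)⁻¹ * (p ^ 2 * q ^ 2) = ((J + o : ℕ) : ℝ) * p ^ 2 := by field_simp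
    have e2 : (((J + o : ℕ) : ℝ) + ((1 : ℕ) : ℝ)) * (p ^ 2)⁻¹ * (p ^ 2 * q ^ 2) = (((J + o : ℕ) : ℝ) + 1) * q ^ 2 := by push_cast; field_simp
    have := mul_le_mul_of_nonneg_right hcv (show 0 ≤ p ^ 2 * q ^ 2 by positivity)
    rw [e1, e2] at this; exact this
  have ho' : (o : ℝ) ≤ ((J + o : ℕ) : ℝ) := by exact_mod_cast (show o ≤ J + o by omega)
  have hq2p2 : q ^ 2 ≤ p ^ 2 := pow_le_pow_left₀ hq0.le hqp 2
  -- o (p² − q²) ≤ (J+o)(p² − q²) ≤ q² ≤ p²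
  have hA : (o : ℝ) * (p ^ 2 - q ^ 2) ≤ p ^ 2 := by
    have h1 : ((J + o : ℕ) : ℝ) * (p ^ 2 - q ^ 2) ≤ q ^ 2 := by nlinarith
    have h2 : (o : ℝ) * (p ^ 2 - q ^ 2) ≤ ((J + o : ℕ) : ℝ) * (p ^ 2 - q ^ 2) := mul_le_mul_of_nonneg_right ho' (by nlinarith)
    linarith
  have hcube : p ^ 3 - q ^ 3 ≤ 3 / 2 * p * (p ^ 2 - q ^ 2) := by
    nlinarith [mul_nonneg (sq_nonneg (p - q)) (show 0 ≤ p + 2 * q by linarith)]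
  have hB : (o : ℝ) * (p ^ 3 - q ^ 3) ≤ 3 / 2 * p ^ 3 := by
    have := mul_le_mul_of_nonneg_left hcube (Nat.cast_nonneg o)
    nlinarith [mul_le_mul_of_nonneg_left hA (show 0 ≤ 3 / 2 * p by positivity)]
  have hkey : (o : ℝ) * (L o * p ^ 3 / 2 - L o * q ^ 3 / 2) ≤ 3 / 2 * (L o * p ^ 3 / 2) := by
    have := mul_le_mul_of_nonneg_left hB (show 0 ≤ L o / 2 by positivity); nlinarith
  have hcJ : L o * p ^ 3 / 2 ≤ L o * h (n + o) ^ 3 / 2 := hcmono' n J hnJ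
  have hcJ1 : L o * q ^ 3 / 2 ≤ L o * h (n + o) ^ 3 / 2 := hcmono' n (J + 1) (by omega)
  linarith

end Summit.QuantumFields.BalabanUV.Beta.EriceRemainderEnclosureHistoryAutonomyComparisonAgeCompositionKeyFreeTwoAgesPrep

end
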